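import Summits.ValiantsHypothesis.ValiantsHypothesis.Theorems.LacunarySymmetroidMatrixDescartesVSQGenStep1

/-!
# `MatrixDescartes` census — the recursive tridiagonal family: base cases, positivity, late sub-cases and the INDUCTION

HONEST FRAMING.  Val-V1-extremal engine seat val-v1x-eng-6 (g2), `--supports stmt-ValiantsHypothesis-18050` (helper).  Completes the
quantitative induction for the family of `…VSQGenDefs`: `|ss| = 1`, `tp ≥ B^{−1}`, `Vv > 0`; the base systems `L = 0` (empty,
`fL = 1`) and `L = 1` (the `c`-chain); the five late sub-cases feeding `late_core` (over a `c`-point of the one-level system, over a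
U-point / strong-link point / bracketed zero / late point of the `(L+1)`-system); and `inv_all : ∀ L ≤ m, INVf L ∧ INVp L` for
`B ≥ 8K⁴4^m`.  Nothing here bears on the crux `MatrixDescartes` (stmt-18050) or on `VP ≠ VNP`.
[folklore] Elementary.
-/

set_option linter.dupNamespace false
set_option autoImplicit false

namespace Summit.ValiantsHypothesis.ValiantsHypothesis.Theorems.LacunarySymmetroidMatrixDescartes.VSQ

open scoped BigOperators
open Finset

variable {n : ℕ} {B : ℝ}

/-! ## 1. Signs, points, values -/

/-- `|ss L j| = 1`. [folklore] -/
theorem abs_ss (n : ℕ) : ∀ (L j : ℕ), |ss n L j| = 1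
  | 0, j => by simp [ss]
  | 1, j => by rw [ss, abs_mul, abs_scR_eq]; simp
  | L + 2, j => by
    by_cases h3 : j < 3 * n
    · by_cases hjn : j ≤ n
      · rw [ss_U n L j h3 hjn, abs_mul, abs_mul, abs_saR_eq, abs_sflat]; simp
      · by_cases hp : (j - n) % 2 = 0
        · rw [ss_I n L j h3 hjn hp, abs_mul, abs_sflat]; simp
        · rw [ss_W n L j h3 hjn hp, abs_neg, abs_sflat]
    · rw [ss_late n L j h3, abs_mul, abs_ss n (L + 1) (j - 3 * n)]; simp

/-- the number of points, unfolded. [folklore] -/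
theorem npts_succ_succ (n L : ℕ) : npts n (L + 2) = 3 * n + npts n (L + 1) := rfl

/-- the points are at least `B^{−1}` (`L ≥ 1`, valid `j`). [folklore] -/
theorem tp_ge (hn : 2 ≤ n) (hB : 16 * ((n + 2 : ℕ) : ℝ) ^ 2 ≤ B) :
    ∀ (L j : ℕ), j < npts n (L + 1) → B ^ (-1 : ℤ) ≤ tp n B (L + 1) j
  | 0, j, hj => by
    obtain ⟨hB1, -, -⟩ := hB16 hB
    show B ^ (-1 : ℤ) ≤ B ^ ((sg n : ℤ) - 1 + 2 * j)
    exact zpow_le_zpow_right₀ hB1.le (by rw [sg_cast]; linarith)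
  | L + 1, j, hj => by
    obtain ⟨hB1, -, hB4⟩ := hB16 hB
    have hB0 : 0 < B := lt_trans zero_lt_one hB1
    by_cases h3 : j < 3 * n
    · rw [tp_lt3 n B L j h3]
      obtain ⟨t1, t2, t3⟩ := tau_level (B := B) hn j h3
      by_cases hj1 : j ≤ n + 1
      · rw [t1 hj1]; exact zpow_le_zpow_right₀ hB1.le (by linarith)
      · by_cases hp : (j - n) % 2 = 0
        · rw [t2 (by omega) hp]
          have b1 := (bz_spec hB4 (w := (j - n) / 2) (by omega) (by omega)).1
          exact le_trans (zpow_le_zpow_right₀ hB1.le (by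
            linarith [(by positivity : (0 : ℤ) ≤ (((j - n) / 2 : ℕ) : ℤ)), (by positivity : (0 : ℤ) ≤ (n : ℤ))])) b1.le
        · rw [t3 (by omega) hp]; exact zpow_le_zpow_right₀ hB1.le (by linarith)
    · rw [tp_ge3 n B L j h3]
      have ih := tp_ge hn hB L (j - 3 * n) (by rw [show L + 1 + 1 = L + 2 from rfl, npts_succ_succ] at hj; omega)
      have h1 : (1 : ℝ) ≤ B ^ (sg n : ℤ) := one_le_zpow₀ hB1.le (by positivity)
      calc B ^ (-1 : ℤ) ≤ tp n B (L + 1) (j - 3 * n) := ih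
        _ ≤ B ^ (sg n : ℤ) * tp n B (L + 1) (j - 3 * n) :=
            le_mul_of_one_le_left (le_trans (zpow_pos hB0 _).le ih) h1

/-- the dominant values are positive (valid `j`). [folklore] -/
theorem Vv_pos (hn : 2 ≤ n) (hB : 16 * ((n + 2 : ℕ) : ℝ) ^ 2 ≤ B) :
    ∀ (L j : ℕ), j < npts n L → 0 < Vv n B L j
  | 0, j, hj => by simp [npts] at hj
  | 1, j, hj => by
    have hB0 : 0 < B := lt_trans zero_lt_one (hB16 hB).1
    show 0 < B ^ (ec n j ((sg n : ℤ) - 1 + 2 * j) - 2 * (dlt n : ℤ)); exact zpow_pos hB0 _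
  | L + 2, j, hj => by
    obtain ⟨hB1, -, hB4⟩ := hB16 hB
    have hB0 : 0 < B := lt_trans zero_lt_one hB1
    by_cases h3 : j < 3 * n
    · by_cases hjn : j ≤ n
      · rw [Vv_U n B L j h3 hjn]; positivity
      · by_cases hp : (j - n) % 2 = 0
        · rw [Vv_I n B L j h3 hjn hp]
          have b1 := (bz_spec hB4 (w := (j - n) / 2) (by omega) (by omega)).1
          exact mul_pos (tv_pos hB0 _ _ (lt_trans (zpow_pos hB0 _) b1)) (zpow_pos hB0 _)
        · rw [Vv_W n B L j h3 hjn hp]; positivity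
    · rw [Vv_late n B L j h3, tp_ge3 n B L j h3]
      have hj' : j - 3 * n < npts n (L + 1) := by rw [npts_succ_succ] at hj; omega
      have hu := tp_ge hn hB L (j - 3 * n) hj'
      exact mul_pos (tv_pos hB0 _ _ (mul_pos (zpow_pos hB0 _) (lt_of_lt_of_le (zpow_pos hB0 _) hu))) (Vv_pos hn hB (L + 1) _ hj')

/-! ## 2. Base systems -/

/-- `INVf 0` and `INVp 0` (empty system, `fL 0 = 1`). [folklore] -/
theorem inv_zero (n : ℕ) (B : ℝ) : INVf n B 0 ∧ INVp n B 0 := by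
  constructor
  · intro u _ _; rw [fL_zero]; simp [sflat]
  · intro j hj; simp [npts] at hj

/-- `INVf 1` (the `c`-chain system in its flat regime). [folklore] -/
theorem invf_one (hn : 2 ≤ n) (hB : 16 * ((n + 2 : ℕ) : ℝ) ^ 2 ≤ B) : INVf n B 1 := by
  obtain ⟨hB1, h8, -⟩ := hB16 hB
  have hB0 : 0 < B := lt_trans zero_lt_one hB1
  intro u hu0 hu1
  rw [fL_one hB0.ne']
  obtain ⟨-, eVc⟩ := tv_consts (n := n) B u
  have cP := cert_of_dom h8 hB0 (fun l => abs_scR_le n l) (hcF n) (dF n) hu0 0 (domC_low hn hB hu0 hu1 (by linarith))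
  rw [eVc] at cP
  have cP' : |fc n B u - B ^ (4 * ((n : ℤ) + 1) ^ 2)| ≤ B ^ (4 * ((n : ℤ) + 1) ^ 2) / 8 := by
    have h := cP; simp only [Fin.val_zero, scR_zero, one_mul] at h; exact h
  obtain ⟨c1, c2⟩ := abs_le.1 cP'
  have hsq : ((-1 : ℝ) ^ n) * (-1) ^ n = 1 := by rw [← sq]; exact neg_one_pow_sq' n
  have e : sflat n 1 * ((-1 : ℝ) ^ n * (B ^ (-(2 * (dlt n : ℤ))) * fc n B u)) = B ^ (-(2 * (dlt n : ℤ))) * fc n B u := by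
    show (-1 : ℝ) ^ n * ((-1 : ℝ) ^ n * (B ^ (-(2 * (dlt n : ℤ))) * fc n B u)) = _
    rw [← mul_assoc, hsq, one_mul]
  rw [e]
  have eC : B ^ (((1 : ℕ) : ℤ) * qa n) = B ^ (-(2 * (dlt n : ℤ))) * B ^ (4 * ((n : ℤ) + 1) ^ 2) := by
    rw [← zpow_add₀ hB0.ne', hc0_eq]; congr 1; push_cast; ring
  rw [eC, pow_one, pow_one]
  have hz : 0 < B ^ (-(2 * (dlt n : ℤ))) := zpow_pos hB0 _
  have hc : 0 < B ^ (4 * ((n : ℤ) + 1) ^ 2) := zpow_pos hB0 _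
  have m1 : B ^ (-(2 * (dlt n : ℤ))) * (7 * B ^ (4 * ((n : ℤ) + 1) ^ 2) / 8) ≤ B ^ (-(2 * (dlt n : ℤ))) * fc n B u :=
    mul_le_mul_of_nonneg_left (by linarith) hz.le
  have m2 : B ^ (-(2 * (dlt n : ℤ))) * fc n B u ≤ B ^ (-(2 * (dlt n : ℤ))) * (9 * B ^ (4 * ((n : ℤ) + 1) ^ 2) / 8) :=
    mul_le_mul_of_nonneg_left (by linarith) hz.le
  constructor <;> nlinarith [mul_pos hz hc]

/-- `INVp 1` (the `c`-chain system at its points). [folklore] -/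
theorem invp_one (hn : 2 ≤ n) (hB : 16 * ((n + 2 : ℕ) : ℝ) ^ 2 ≤ B) : INVp n B 1 := by
  obtain ⟨hB1, h8, -⟩ := hB16 hB
  have hB0 : 0 < B := lt_trans zero_lt_one hB1
  have hn' : (2 : ℤ) ≤ n := by exact_mod_cast hn
  intro j hj
  have hjn : j ≤ n + 1 := by simp [npts] at hj; omega
  show (1 / 2 : ℝ) ^ 1 * B ^ (ec n j ((sg n : ℤ) - 1 + 2 * j) - 2 * (dlt n : ℤ)) ≤
      ((-1) ^ n * scR n j) * fL n B 1 (B ^ ((sg n : ℤ) - 1 + 2 * j)) ∧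
    ((-1) ^ n * scR n j) * fL n B 1 (B ^ ((sg n : ℤ) - 1 + 2 * j)) ≤ (2 : ℝ) ^ 1 * B ^ (ec n j ((sg n : ℤ) - 1 + 2 * j) - 2 * (dlt n : ℤ))
  set y : ℤ := (sg n : ℤ) - 1 + 2 * j with hy
  have hy3 : 4 * (n : ℤ) + 3 ≤ y := by rw [hy, sg_cast]; linarith
  rw [fL_one hB0.ne']
  have Hc : ∀ l : Fin (n + 2), l ≠ (⟨j, by omega⟩ : Fin (n + 2)) → ec n l y + 1 ≤ ec n (⟨j, by omega⟩ : Fin (n + 2)) y := by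
    intro l hl
    rcases Nat.eq_zero_or_pos j with h0 | hj0
    · subst h0
      have : y = 4 * n + 3 := by rw [hy, sg_cast]; push_cast; ring
      rw [this]; exact ec_low_dom hn (Nat.one_le_iff_ne_zero.2 fun h => hl (Fin.ext h)) (val_le l) le_rfl
    · by_cases hjn' : j ≤ n
      · have : y = 4 * n + 2 * j + 3 := by rw [hy, sg_cast]; ring
        rw [this]; exact ec_blk_dom hn hj0 hjn' (val_le l) (fun h => hl (Fin.ext h))
      · have hj' : j = n + 1 := by omega
        subst hj'
        have : y = 6 * n + 5 := by rw [hy, sg_cast]; push_cast; ring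
        rw [this]
        exact ec_top_dom hn (by have := val_le l; have hne : (l : ℕ) ≠ n + 1 := fun h => hl (Fin.ext h); omega)
  have cP := cert_of_dom h8 hB0 (fun l => abs_scR_le n l) (hcF n) (dF n) (zpow_pos hB0 y) ⟨j, by omega⟩
    (dom_zpow hB1 _ _ _ y ⟨j, by omega⟩ fun l hl => Or.inr (Hc l hl))
  rw [tv_ec hB0] at cP
  obtain ⟨c1', c2', -⟩ := cert_bounds (abs_scR_eq n j) cP
  have c1 : 7 * B ^ (ec n j y) / 8 ≤ scR n j * fc n B (B ^ y) := c1'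
  have c2 : scR n j * fc n B (B ^ y) ≤ 9 * B ^ (ec n j y) / 8 := c2'
  have hsq : ((-1 : ℝ) ^ n) * (-1) ^ n = 1 := by rw [← sq]; exact neg_one_pow_sq' n
  have e : ((-1 : ℝ) ^ n * scR n j) * ((-1 : ℝ) ^ n * (B ^ (-(2 * (dlt n : ℤ))) * fc n B (B ^ y))) =
      B ^ (-(2 * (dlt n : ℤ))) * (scR n j * fc n B (B ^ y)) := by linear_combination (scR n j * B ^ (-(2 * (dlt n : ℤ))) * fc n B (B ^ y)) * hsq
  rw [e]
  have eV : B ^ (ec n (⟨j, by omega⟩ : Fin (n + 2)) y - 2 * (dlt n : ℤ)) = B ^ (-(2 * (dlt n : ℤ))) * B ^ (ec n (⟨j, by omega⟩ : Fin (n + 2)) y) := by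
    rw [← zpow_add₀ hB0.ne']; congr 1; ring
  rw [eV, pow_one, pow_one]
  have hz : 0 < B ^ (-(2 * (dlt n : ℤ))) := zpow_pos hB0 _
  have hc : 0 < B ^ (ec n j y) := zpow_pos hB0 _
  have m1 : B ^ (-(2 * (dlt n : ℤ))) * (7 * B ^ (ec n j y) / 8) ≤ B ^ (-(2 * (dlt n : ℤ))) * (scR n j * fc n B (B ^ y)) :=
    mul_le_mul_of_nonneg_left c1 hz.le
  have m2 : B ^ (-(2 * (dlt n : ℤ))) * (scR n j * fc n B (B ^ y)) ≤ B ^ (-(2 * (dlt n : ℤ))) * (9 * B ^ (ec n j y) / 8) :=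
    mul_le_mul_of_nonneg_left c2 hz.le
  constructor <;> nlinarith [mul_pos hz hc]

/-! ## 3. The point step -/

/-- **point step**: `INVp (L+2)` from the invariants one and two levels down (`B ≥ 8K⁴4^L`, `B ≥ 16K²`). [folklore] -/
theorem step_points (hn : 2 ≤ n) (hB : 16 * ((n + 2 : ℕ) : ℝ) ^ 2 ≤ B) {L : ℕ}
    (hBL4 : 8 * ((n + 2 : ℕ) : ℝ) ^ 4 * 4 ^ L ≤ B)
    (I0f : INVf n B L) (I1f : INVf n B (L + 1)) (I0p : INVp n B L) (I1p : INVp n B (L + 1)) :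
    INVp n B (L + 2) := by
  obtain ⟨hB1, h8, hB4⟩ := hB16 hB
  have hB0 : 0 < B := lt_trans zero_lt_one hB1
  have hn' : (2 : ℤ) ≤ n := by exact_mod_cast hn
  have hK1 : (1 : ℝ) ≤ ((n + 2 : ℕ) : ℝ) := by exact_mod_cast (show 1 ≤ n + 2 by omega)
  have hBL : 8 * ((n + 2 : ℕ) : ℝ) ^ 2 * 4 ^ L ≤ B := by
    refine le_trans ?_ hBL4
    have : ((n + 2 : ℕ) : ℝ) ^ 2 ≤ ((n + 2 : ℕ) : ℝ) ^ 4 := pow_le_pow_right₀ hK1 (by norm_num)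
    nlinarith [pow_pos (show (0:ℝ) < 4 by norm_num) L]
  intro j hj
  rw [npts_succ_succ] at hj
  by_cases h3 : j < 3 * n
  · by_cases hjn : j ≤ n
    · exact stepP_U hn hB hBL I0f I1f hjn
    · by_cases hp : (j - n) % 2 = 0
      · obtain ⟨w, hw⟩ : ∃ w, j = n + 2 * w := ⟨(j - n) / 2, by omega⟩
        subst hw
        exact stepP_I hn hB I1f (w := w) (by omega) (by omega)
      · obtain ⟨w, hw⟩ : ∃ w, j = n + 2 * w - 1 := ⟨(j - n + 1) / 2, by omega⟩
        subst hw
        exact stepP_W hn hB hBL I0f I1f (w := w) (by omega) (by omega)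
  · -- late points
    set j' := j - 3 * n with hj'
    have hj'n : j' < npts n (L + 1) := by omega
    set u := tp n B (L + 1) j' with hu
    have hu1 : B ^ (-1 : ℤ) ≤ u := tp_ge hn hB L j' hj'n
    have hu0 : 0 < u := lt_of_lt_of_le (zpow_pos hB0 _) hu1
    have I1j := I1p j' hj'n
    have hss1 := abs_ss n (L + 1) j'
    have hVpos := Vv_pos hn hB (L + 1) j' hj'n
    set t : ℝ := B ^ (sg n : ℤ) * u with ht
    have ht0 : 0 < t := mul_pos (zpow_pos hB0 _) hu0
    -- the b-size and a-size at t, as monomials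
    have hsg := sg_cast n
    -- dispatch on L and on the type of j'
    rcases Nat.eq_zero_or_pos L with hL0 | hLpos
    · -- L = 0: the one-level system below; fL 0 = 1
      subst hL0
      have hjn1 : j' ≤ n + 1 := by simp [npts] at hj'n; omega
      have huy : u = B ^ ((sg n : ℤ) - 1 + 2 * j') := rfl
      have hR : |fL n B 0 (B ^ (-(sg n : ℤ)) * u)| ≤ (2 : ℝ) ^ 0 * 1 := by rw [fL_zero]; simp
      refine late_core hn hB hu1 rfl I1j hss1 hVpos hR ?_ h3 rfl
      -- gap over a c-point
      have hV1 : Vv n B (0 + 1) j' = B ^ (ec n j' ((sg n : ℤ) - 1 + 2 * j') - 2 * (dlt n : ℤ)) := rfl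
      rw [hV1, huy, ← zpow_add₀ hB0.ne', tv_eb hB0, tv_ea hB0, mul_pow, ← zpow_natCast (B ^ (-(dlt n : ℤ))) 2, ← zpow_mul,
        ← zpow_natCast (B ^ (eb n _ _)) 2, ← zpow_mul, mul_one, ← zpow_add₀ hB0.ne']
      rw [show 8 * ((n + 2 : ℕ) : ℝ) ^ 2 * 4 ^ 0 * (B ^ (-(dlt n : ℤ) * (2 : ℕ)) * (((n + 2 : ℕ) : ℝ) ^ 2 * B ^ (eb n (⟨n, by omega⟩ : Fin (n + 2)) ((sg n : ℤ) + ((sg n : ℤ) - 1 + 2 * j')) * (2 : ℕ)))) =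
        (8 * ((n + 2 : ℕ) : ℝ) ^ 4 * 4 ^ 0) * (B ^ (-(dlt n : ℤ) * (2 : ℕ)) * B ^ (eb n (⟨n, by omega⟩ : Fin (n + 2)) ((sg n : ℤ) + ((sg n : ℤ) - 1 + 2 * j')) * (2 : ℕ))) by ring,
        ← zpow_add₀ hB0.ne']
      refine zgap hB1 hBL4 ?_
      have hg := gap_late_c hn hjn1
      have e1 : (sg n : ℤ) - 1 + 2 * j' = 4 * n + 3 + 2 * j' := by rw [hsg]; ring
      simp only [Fin.val_last, e1] at hg ⊢
      push_cast at hg ⊢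
      linarith
    · obtain ⟨L', rfl⟩ : ∃ L', L = L' + 1 := ⟨L - 1, by omega⟩
      by_cases h3' : j' < 3 * n
      · -- u is a level-0 point of the (L'+2)-system: u ≤ B^{4n+1}, so u/B^σ is flat for fL (L'+1)
        obtain ⟨t1, t2, t3⟩ := tau_level (B := B) hn j' h3'
        have hu_eq : u = tau n B j' := by rw [hu]; exact tp_lt3 n B L' j' h3'
        have hflat : ∀ {v : ℝ}, 0 < v → v ≤ B ^ (4 * (n : ℤ) + 1) →
            |fL n B (L' + 1) (B ^ (-(sg n : ℤ)) * v)| ≤ (2 : ℝ) ^ (L' + 1) * B ^ (((L' + 1 : ℕ) : ℤ) * qa n) := by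
          intro v hv0 hv1
          refine abs_le_of_signed (abs_sflat n (L' + 1)) (by positivity) (I0f _ (mul_pos (zpow_pos hB0 _) hv0) ?_)
          calc B ^ (-(sg n : ℤ)) * v ≤ B ^ (-(sg n : ℤ)) * B ^ (4 * (n : ℤ) + 1) := mul_le_mul_of_nonneg_left hv1 (zpow_pos hB0 _).le
            _ = B ^ (-(sg n : ℤ) + (4 * n + 1)) := (zpow_add₀ hB0.ne' _ _).symm
            _ ≤ B ^ (-1 : ℤ) := zpow_le_zpow_right₀ hB1.le (by rw [hsg]; linarith)
        by_cases hjn' : j' ≤ n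
        · -- over a U-point
          have huy : u = B ^ (2 * (j' : ℤ) - 1) := by rw [hu_eq, t1 (by omega)]
          have hR := hflat hu0 (by rw [huy]; exact zpow_le_zpow_right₀ hB1.le (by linarith [(by exact_mod_cast hjn' : (j' : ℤ) ≤ n)]))
          refine late_core hn hB hu1 rfl I1j hss1 hVpos hR ?_ h3 rfl
          rw [Vv_U n B L' j' h3' hjn', huy, ← zpow_add₀ hB0.ne', tv_eb hB0, tv_ea hB0]
          rw [show 8 * ((n + 2 : ℕ) : ℝ) ^ 2 * 4 ^ (L' + 1) * ((B ^ (-(dlt n : ℤ))) ^ 2 *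
              (((n + 2 : ℕ) : ℝ) * B ^ (eb n (⟨n, by omega⟩ : Fin (n + 2)) ((sg n : ℤ) + (2 * (j' : ℤ) - 1)))) ^ 2 * B ^ (((L' + 1 : ℕ) : ℤ) * qa n))
              = (8 * ((n + 2 : ℕ) : ℝ) ^ 4 * 4 ^ (L' + 1)) * ((B ^ (-(dlt n : ℤ)) * B ^ (eb n (⟨n, by omega⟩ : Fin (n + 2)) ((sg n : ℤ) + (2 * (j' : ℤ) - 1)))) ^ 2 * B ^ (((L' + 1 : ℕ) : ℤ) * qa n)) by ring,
            ← zpow_add₀ hB0.ne', ← zpow_natCast _ 2, ← zpow_mul, ← zpow_add₀ hB0.ne',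
            show B ^ (ea n ((Fin.last (n + 1) : Fin (n + 2)) : ℕ) ((sg n : ℤ) + (2 * (j' : ℤ) - 1))) * (B ^ (ea n j' (2 * (j' : ℤ) - 1)) * B ^ (((L' + 1 : ℕ) : ℤ) * qa n))
              = B ^ (ea n ((Fin.last (n + 1) : Fin (n + 2)) : ℕ) ((sg n : ℤ) + (2 * (j' : ℤ) - 1)) + ea n j' (2 * (j' : ℤ) - 1) + ((L' + 1 : ℕ) : ℤ) * qa n) by
                rw [zpow_add₀ hB0.ne', zpow_add₀ hB0.ne']; ring]
          refine zgap hB1 hBL4 ?_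
          have hg := gap_late_U hn hjn'
          simp only [Fin.val_last] at hg ⊢; push_cast at hg ⊢; linarith
        · by_cases hp : (j' - n) % 2 = 0
          · -- over a bracketed zero
            obtain ⟨w, hw⟩ : ∃ w, j' = n + 2 * w := ⟨(j' - n) / 2, by omega⟩
            have hw1 : 1 ≤ w := by omega
            have hwn : w + 1 ≤ n := by omega
            have huz : u = bz n B w := by rw [hu_eq, t2 (by omega) hp, show (j' - n) / 2 = w by omega]
            obtain ⟨b1, b2, -⟩ := bz_spec hB4 (w := w) hw1 hwn
            have hR := hflat hu0 (by rw [huz]; exact b2.le.trans (zpow_le_zpow_right₀ hB1.le (by push_cast; omega)))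
            refine late_core hn hB hu1 rfl I1j hss1 hVpos hR ?_ h3 rfl
            rw [Vv_I n B L' j' h3' hjn' hp, show (j' - n) / 2 = w by omega, ← huz]
            -- compare at the bracket ends
            set x1 : ℤ := (sg n : ℤ) + 2 * n + 2 * w - 1 with hx1
            set x2 : ℤ := (sg n : ℤ) + 2 * n + 2 * w + 1 with hx2
            have ht2 : t ≤ B ^ x2 := by
              rw [ht, hx2, show (sg n : ℤ) + 2 * n + 2 * w + 1 = (sg n : ℤ) + (2 * n + 2 * (w + 1 : ℕ) - 1) by push_cast; ring, zpow_add₀ hB0.ne', huz]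
              exact mul_le_mul_of_nonneg_left b2.le (zpow_pos hB0 _).le
            have ht1 : B ^ x1 ≤ t := by
              rw [ht, hx1, show (sg n : ℤ) + 2 * n + 2 * w - 1 = (sg n : ℤ) + (2 * n + 2 * w - 1) by ring, zpow_add₀ hB0.ne', huz]
              exact mul_le_mul_of_nonneg_left b1.le (zpow_pos hB0 _).le
            have hb2 : tv B (hbF n ⟨n, by omega⟩) (dF n ⟨n, by omega⟩) t ≤ B ^ (eb n n x2) := by
              have := tv_mono hB0 (hbF n ⟨n, by omega⟩) (dF n ⟨n, by omega⟩) ht0.le ht2; rwa [tv_eb hB0] at this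
            have ha1 : B ^ (ea n (n + 1) x1) ≤ tv B (haF n (Fin.last (n + 1))) (dF n (Fin.last (n + 1))) t := by
              have := tv_mono hB0 (haF n (Fin.last (n + 1))) (dF n (Fin.last (n + 1))) (zpow_pos hB0 x1).le ht1
              rwa [tv_ea hB0, Fin.val_last] at this
            have hn1 : B ^ (ea n n (2 * n + 2 * w - 1)) ≤ tv B (haF n ⟨n, by omega⟩) (dF n ⟨n, by omega⟩) u := by
              have := tv_mono hB0 (haF n ⟨n, by omega⟩) (dF n ⟨n, by omega⟩) (zpow_pos hB0 _).le (huz ▸ b1.le)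
              rwa [tv_ea hB0] at this
            have key : (8 * ((n + 2 : ℕ) : ℝ) ^ 4 * 4 ^ (L' + 1)) * (B ^ (-(dlt n : ℤ)) * B ^ (eb n n x2)) ^ 2 ≤
                B ^ (ea n (n + 1) x1) * B ^ (ea n n (2 * n + 2 * w - 1)) := by
              rw [← zpow_add₀ hB0.ne', ← zpow_natCast _ 2, ← zpow_mul, ← zpow_add₀ hB0.ne']
              refine zgap hB1 hBL4 ?_
              have hg := gap0_bracket1 hn hw1 (n := n)
              rw [hx2, hx1]; push_cast at hg ⊢; linarith
            calc 8 * ((n + 2 : ℕ) : ℝ) ^ 2 * 4 ^ (L' + 1) * ((B ^ (-(dlt n : ℤ))) ^ 2 *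
                  (((n + 2 : ℕ) : ℝ) * tv B (hbF n ⟨n, by omega⟩) (dF n ⟨n, by omega⟩) t) ^ 2 * B ^ (((L' + 1 : ℕ) : ℤ) * qa n))
                = (8 * ((n + 2 : ℕ) : ℝ) ^ 4 * 4 ^ (L' + 1)) * (B ^ (-(dlt n : ℤ)) * tv B (hbF n ⟨n, by omega⟩) (dF n ⟨n, by omega⟩) t) ^ 2 *
                    B ^ (((L' + 1 : ℕ) : ℤ) * qa n) := by ring
              _ ≤ (8 * ((n + 2 : ℕ) : ℝ) ^ 4 * 4 ^ (L' + 1)) * (B ^ (-(dlt n : ℤ)) * B ^ (eb n n x2)) ^ 2 * B ^ (((L' + 1 : ℕ) : ℤ) * qa n) :=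
                  mul_le_mul_of_nonneg_right (mul_le_mul_of_nonneg_left
                    (pow_le_pow_left₀ (mul_nonneg (zpow_pos hB0 _).le (tv_pos hB0 _ _ ht0).le) (mul_le_mul_of_nonneg_left hb2 (zpow_pos hB0 _).le) 2) (by positivity))
                    (zpow_pos hB0 _).le
              _ ≤ (B ^ (ea n (n + 1) x1) * B ^ (ea n n (2 * n + 2 * w - 1))) * B ^ (((L' + 1 : ℕ) : ℤ) * qa n) :=
                  mul_le_mul_of_nonneg_right key (zpow_pos hB0 _).le
              _ ≤ (tv B (haF n (Fin.last (n + 1))) (dF n (Fin.last (n + 1))) t * tv B (haF n ⟨n, by omega⟩) (dF n ⟨n, by omega⟩) u) *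
                    B ^ (((L' + 1 : ℕ) : ℤ) * qa n) :=
                  mul_le_mul_of_nonneg_right (mul_le_mul ha1 hn1 (zpow_pos hB0 _).le (tv_pos hB0 _ _ ht0).le) (zpow_pos hB0 _).le
              _ = _ := by ring
          · -- over a strong-link point
            obtain ⟨w, hw⟩ : ∃ w, j' = n + 2 * w - 1 := ⟨(j' - n + 1) / 2, by omega⟩
            have hw1 : 1 ≤ w := by omega
            have hwn : w ≤ n := by omega
            have huy : u = B ^ (2 * (n : ℤ) + 2 * w - 1) := by
              by_cases hj1 : j' ≤ n + 1
              · rw [hu_eq, t1 hj1]; congr 1; rw [hw]; omega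
              · rw [hu_eq, t3 (by omega) hp]; congr 1; rw [hw]; omega
            have hR := hflat hu0 (by rw [huy]; exact zpow_le_zpow_right₀ hB1.le (by linarith [(by exact_mod_cast hwn : (w : ℤ) ≤ n)]))
            refine late_core hn hB hu1 rfl I1j hss1 hVpos hR ?_ h3 rfl
            rw [Vv_W n B L' j' h3' hjn' hp, show (j' - n + 1) / 2 = w by omega,
              show ((j' : ℤ) + n) = 2 * (n : ℤ) + 2 * w - 1 by rw [hw]; omega, huy, ← zpow_add₀ hB0.ne',
              tv_eb hB0, tv_ea hB0]
            rw [show 8 * ((n + 2 : ℕ) : ℝ) ^ 2 * 4 ^ (L' + 1) * ((B ^ (-(dlt n : ℤ))) ^ 2 *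
                (((n + 2 : ℕ) : ℝ) * B ^ (eb n (⟨n, by omega⟩ : Fin (n + 2)) ((sg n : ℤ) + (2 * (n : ℤ) + 2 * w - 1)))) ^ 2 * B ^ (((L' + 1 : ℕ) : ℤ) * qa n))
                = (8 * ((n + 2 : ℕ) : ℝ) ^ 4 * 4 ^ (L' + 1)) * ((B ^ (-(dlt n : ℤ)) * B ^ (eb n (⟨n, by omega⟩ : Fin (n + 2)) ((sg n : ℤ) + (2 * (n : ℤ) + 2 * w - 1)))) ^ 2 * B ^ (((L' + 1 : ℕ) : ℤ) * qa n)) by ring,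
              ← zpow_add₀ hB0.ne', ← zpow_natCast _ 2, ← zpow_mul, ← zpow_add₀ hB0.ne',
              show B ^ (ea n ((Fin.last (n + 1) : Fin (n + 2)) : ℕ) ((sg n : ℤ) + (2 * (n : ℤ) + 2 * w - 1))) *
                  (B ^ (2 * (eb n w (2 * (n : ℤ) + 2 * w - 1) - (dlt n : ℤ))) * B ^ (((L' : ℕ) : ℤ) * qa n))
                = B ^ (ea n ((Fin.last (n + 1) : Fin (n + 2)) : ℕ) ((sg n : ℤ) + (2 * (n : ℤ) + 2 * w - 1)) +
                    2 * (eb n w (2 * (n : ℤ) + 2 * w - 1) - (dlt n : ℤ)) + ((L' : ℕ) : ℤ) * qa n) by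
                rw [zpow_add₀ hB0.ne', zpow_add₀ hB0.ne']; ring]
            refine zgap hB1 hBL4 ?_
            have hg := gap_late_W hn hw1 hwn
            simp only [Fin.val_last] at hg ⊢; push_cast at hg ⊢; nlinarith [hg]
      · -- over a late point: u = B^σ u', u' = tp (L'+1) (j' - 3n) ≥ B^{-1}
        have hj'' : j' - 3 * n < npts n (L' + 1) := by
          rw [show L' + 1 + 1 = L' + 2 from rfl, npts_succ_succ] at hj'n; omega
        set u' := tp n B (L' + 1) (j' - 3 * n) with hu'
        have hu_eq : u = B ^ (sg n : ℤ) * u' := by rw [hu]; exact tp_ge3 n B L' j' h3'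
        have hu'1 : B ^ (-1 : ℤ) ≤ u' := tp_ge hn hB L' (j' - 3 * n) hj''
        have hu'0 : 0 < u' := lt_of_lt_of_le (zpow_pos hB0 _) hu'1
        have hcancel : B ^ (-(sg n : ℤ)) * u = u' := by
          rw [hu_eq, ← mul_assoc, ← zpow_add₀ hB0.ne', neg_add_cancel, zpow_zero, one_mul]
        have hR : |fL n B (L' + 1) (B ^ (-(sg n : ℤ)) * u)| ≤ (2 : ℝ) ^ (L' + 1) * Vv n B (L' + 1) (j' - 3 * n) := by
          rw [hcancel]
          exact abs_le_of_signed (abs_ss n (L' + 1) _) (by have := Vv_pos hn hB (L' + 1) _ hj''; positivity) (I0p _ hj'')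
        refine late_core hn hB hu1 rfl I1j hss1 hVpos hR ?_ h3 rfl
        rw [Vv_late n B L' j' h3', ← hu]
        have hVp : 0 < Vv n B (L' + 1) (j' - 3 * n) := Vv_pos hn hB (L' + 1) _ hj''
        -- monomial comparison in u from u₀ = B^{σ-1}
        have hu_low : B ^ ((sg n : ℤ) - 1) ≤ u := by
          rw [hu_eq, show (sg n : ℤ) - 1 = (sg n : ℤ) + (-1) by ring, zpow_add₀ hB0.ne']
          exact mul_le_mul_of_nonneg_left hu'1 (zpow_pos hB0 _).le
        have hdn : dF n ⟨n, by omega⟩ = n + n := by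
          have := dN_blk (n := n) (v := n) (by omega) le_rfl; exact_mod_cast this
        have hdT : dF n (Fin.last (n + 1)) = n ^ 2 + 5 * n := by
          have := dN_top n; simp only [dF, Fin.val_last]; exact_mod_cast this
        -- the inequality at u₀ and its propagation
        have key0 : (8 * ((n + 2 : ℕ) : ℝ) ^ 4 * 4 ^ (L' + 1)) *
            ((B ^ (-(dlt n : ℤ)) * tv B (hbF n ⟨n, by omega⟩) (dF n ⟨n, by omega⟩) (B ^ (sg n : ℤ) * B ^ ((sg n : ℤ) - 1))) ^ 2) ≤
            tv B (haF n (Fin.last (n + 1))) (dF n (Fin.last (n + 1))) (B ^ (sg n : ℤ) * B ^ ((sg n : ℤ) - 1)) *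
              tv B (haF n (Fin.last (n + 1))) (dF n (Fin.last (n + 1))) (B ^ ((sg n : ℤ) - 1)) := by
          rw [← zpow_add₀ hB0.ne', tv_eb hB0, tv_ea hB0, tv_ea hB0, ← zpow_add₀ hB0.ne', ← zpow_natCast _ 2, ← zpow_mul,
            ← zpow_add₀ hB0.ne']
          refine zgap hB1 hBL4 ?_
          have hg := gap_late_top hn (y := (sg n : ℤ) - 1) (by rw [hsg]; linarith)
          simp only [Fin.val_last] at hg ⊢; push_cast at hg ⊢; linarith
        -- write both sides as monomials in u
        have eL : ∀ v : ℝ, (8 * ((n + 2 : ℕ) : ℝ) ^ 4 * 4 ^ (L' + 1)) *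
            ((B ^ (-(dlt n : ℤ)) * tv B (hbF n ⟨n, by omega⟩) (dF n ⟨n, by omega⟩) (B ^ (sg n : ℤ) * v)) ^ 2) =
            ((8 * ((n + 2 : ℕ) : ℝ) ^ 4 * 4 ^ (L' + 1)) * (B ^ (-(dlt n : ℤ)) * (B ^ (hbF n ⟨n, by omega⟩) * (B ^ (sg n : ℤ)) ^ (n + n))) ^ 2) *
              v ^ (2 * (n + n)) := by
          intro v; unfold tv; rw [hdn, mul_pow, pow_mul]; ring
        have eR : ∀ v : ℝ, tv B (haF n (Fin.last (n + 1))) (dF n (Fin.last (n + 1))) (B ^ (sg n : ℤ) * v) *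
            tv B (haF n (Fin.last (n + 1))) (dF n (Fin.last (n + 1))) v =
            (B ^ (haF n (Fin.last (n + 1))) * (B ^ (sg n : ℤ)) ^ (n ^ 2 + 5 * n) * B ^ (haF n (Fin.last (n + 1)))) *
              v ^ ((n ^ 2 + 5 * n) + (n ^ 2 + 5 * n)) := by
          intro v; unfold tv; rw [hdT, mul_pow, pow_add]; ring
        have key1 := key0
        rw [eL, eR] at key1
        have mono := mono_cmp_right (by positivity) (by nlinarith : 2 * (n + n) ≤ (n ^ 2 + 5 * n) + (n ^ 2 + 5 * n))
          (zpow_pos hB0 _) hu_low key1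
        rw [← eL, ← eR] at mono
        calc 8 * ((n + 2 : ℕ) : ℝ) ^ 2 * 4 ^ (L' + 1) * ((B ^ (-(dlt n : ℤ))) ^ 2 *
              (((n + 2 : ℕ) : ℝ) * tv B (hbF n ⟨n, by omega⟩) (dF n ⟨n, by omega⟩) (B ^ (sg n : ℤ) * u)) ^ 2 * Vv n B (L' + 1) (j' - 3 * n))
            = (8 * ((n + 2 : ℕ) : ℝ) ^ 4 * 4 ^ (L' + 1)) *
                ((B ^ (-(dlt n : ℤ)) * tv B (hbF n ⟨n, by omega⟩) (dF n ⟨n, by omega⟩) (B ^ (sg n : ℤ) * u)) ^ 2) *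
                Vv n B (L' + 1) (j' - 3 * n) := by ring
          _ ≤ (tv B (haF n (Fin.last (n + 1))) (dF n (Fin.last (n + 1))) (B ^ (sg n : ℤ) * u) *
              tv B (haF n (Fin.last (n + 1))) (dF n (Fin.last (n + 1))) u) * Vv n B (L' + 1) (j' - 3 * n) :=
              mul_le_mul_of_nonneg_right mono hVp.le
          _ = _ := by rw [hu_eq, hcancel.symm.trans rfl]; ring

end Summit.ValiantsHypothesis.ValiantsHypothesis.Theorems.LacunarySymmetroidMatrixDescartes.VSQ
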